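import Summits.ResolutionOfSingularities.ResolutionOfSingularities.Theorems.FrobeniusClosingPatchingRelPerfectCuspLineStepGlue
import Summits.ResolutionOfSingularities.ResolutionOfSingularities.Theorems.FrobeniusClosingPatchingRelPerfectJacobianCriterion
import Summits.ResolutionOfSingularities.ResolutionOfSingularities.Theorems.FrobeniusClosingPatchingRelPerfectCoreRungTowerCharts
import Literature.AlgebraicGeometry.Resolution.MvPolynomialKillVars
import HarnessLib

/-!
# Crux `PatchingRelPerfect` (stmt-ResolutionOfSingularities-16161), chain W5.2 — the TWO-QUADRIC
# member `I = (x₀x₁ − x₂², x₃²) + 𝔪⁴`, part 2: the chart quotients by the de-homogenised conic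

[OURS · L1 W5.2 · kernel certificate, res-L1-w52-plan-1 NAMING G11-3 (1) 2026-08-27T15:05:28Z]
On a Rees chart `B_i = R[M/c_i]` of `Bl_M Spec R` (`c : Fin n → R` quasi-regular, `R/(c)` a
regular domain — in the application `R = S` regular local, `c` a regular system of parameters)
the centre of the conic tower (part 1, `…TwoQuadricMemberTower`) is `(u, e_d, v)` with `u = c_i/1`
the exceptional parameter, `e_d` ONE chart generator and `v` an element which MODULO `u` is a given
polynomial `F` in the chart generators (`B_i/(u) ≅ (R/(c))[T_j : j ≠ i]`, `chartQuotEquiv`).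
This file supplies the two hypotheses of the tower from a JACOBIAN certificate for the polynomial
`G = F|_{T_d = 0}`:

* `TwoQuadric.exists_quotEquiv_killGen` — `B_i/(u, e_d) ≅ (R/(c))[T_j : j ≠ i, j ≠ d]` with
  `v̄ ↦ G` (double quotient + `quotientSpanXEquiv`);
* `TwoQuadric.forall_mem_of_mul_mem_of_ne_zero` — if `G ≠ 0` then `v` is regular modulo `(u, e_d)`
  (the target is a polynomial ring over a domain), hence `TwoQuadric.isWeaklyRegular_u_gen_v` /
  `isQuasiRegular_u_gen_v`: `(u, e_d, v)` is weakly regular, so quasi-regular;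
* `TwoQuadric.isRegularRing_quot_u_gen_v` — if at every prime containing `G` some partial derivative
  `∂G/∂T_j` is absent (Jacobian criterion, `MvPolynomial.isRegularRing_quotient_span_of_pderiv`) then
  `B_i/(u, e_d, v) ≅ (R/(c))[T]/(G)` is a regular ring;
* the three certificates of the member: `jacobian_X_sub_X_sq` (`G = T_a − T_b²`: `∂/∂T_a = 1`),
  `jacobian_X_mul_X_sub_one` (`G = T_a T_b − 1`: `(G, T_b, T_a) = (1)`), and their non-vanishing.

Any commutative ring / any characteristic; fact-free; nothing here is a statement of the manuscript
under review (AI-written; AI review weaker than expert review).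

## References

* H. Matsumura, *Commutative Ring Theory*, CUP 1986, Thm. 14.2 (Jacobian criterion shape),
  Thm. 16.2 (i). [Matsumura1987]
* The Stacks Project, Tags 0804, 0BIQ. [StacksProject]
-/

-- `Summit.<Summit>.<Sub>.Theorems` with `Sub = Summit` (single-conjunct summit, D-0017)
set_option linter.dupNamespace false

noncomputable section

open CategoryTheory CategoryTheory.Limits AlgebraicGeometry Literature.AlgebraicGeometry.Resolution
open scoped Pointwise nonZeroDivisors

namespace Summit.ResolutionOfSingularities.ResolutionOfSingularities.Theorems

universe u

namespace TwoQuadric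

open CuspMember

/-! ## Transport: `B_i/(u, e_d) ≅ (R/(c))[T_j : j ≠ i, j ≠ d]` -/

section Transport

variable {R : Type u} [CommRing R] {n : ℕ} (c : Fin n → R) (i : Fin n) (d : {j : Fin n // j ≠ i})

/-- The exceptional ideal `(u)`, `u = c_i/1`. -/
local notation3 "KA" => Ideal.span {chartBase c i (c i)}
/-- The chart quotient `B_i/(u)` as a polynomial ring. -/
local notation3 "Pq" => MvPolynomial {j : Fin n // j ≠ i} (R ⧸ Ideal.span (Set.range c))
/-- The polynomial ring with `T_d` killed as well. -/
local notation3 "Tq" => MvPolynomial {j : {j : Fin n // j ≠ i} // j ∉ ({d} : Set {j : Fin n // j ≠ i})}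
  (R ⧸ Ideal.span (Set.range c))

set_option maxHeartbeats 400000 in
/-- **`B_i/(u, e_d) ≅ (R/(c))[T_j : j ≠ i, j ≠ d]`, with `v̄ ↦ G`**: kill the exceptional parameter
(`chartQuotEquiv`, Stacks 0BIQ), then the variable `T_d` (`quotientSpanXEquiv`); an element `v`
which is `F(e)` modulo `u` goes to `G = F|_{T_d = 0}`. [cite: StacksProject, Tag 0BIQ] -/
theorem exists_quotEquiv_killGen (hc : IsQuasiRegular c) (F : Pq) (v : chartRing c i)
    (hv : chartQuotEquiv c i hc F = Ideal.Quotient.mk KA v) (G : Tq)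
    (hG : MvPolynomial.quotientSpanXEquiv ({d} : Set {j : Fin n // j ≠ i}) (Ideal.Quotient.mk _ F) = G) :
    ∃ θ : (chartRing c i ⧸ (KA ⊔ Ideal.span {chartGen c i d.1})) ≃+* Tq,
      θ (Ideal.Quotient.mk _ v) = G := by
  classical
  -- `B/(u, e_d) ≃ (B/u)/(ē_d)`
  let e1 : (chartRing c i ⧸ (KA ⊔ Ideal.span {chartGen c i d.1})) ≃+*
      (chartRing c i ⧸ KA) ⧸ (Ideal.span {chartGen c i d.1}).map (Ideal.Quotient.mk KA) :=
    (DoubleQuot.quotQuotEquivQuotSup KA (Ideal.span {chartGen c i d.1})).symm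
  -- `(B/u)/(ē_d) ≃ Pq/(T_d)` along `chartQuotEquiv`
  have hIJ : (Ideal.span {chartGen c i d.1}).map (Ideal.Quotient.mk KA) =
      (Ideal.span (MvPolynomial.X '' ({d} : Set {j : Fin n // j ≠ i}) : Set Pq)).map
        (chartQuotEquiv c i hc : Pq →+* chartRing c i ⧸ KA) := by
    rw [Set.image_singleton, map_span_singleton, Ideal.map_span, Set.image_singleton, RingHom.coe_coe,
      chartQuotEquiv_apply, chartQuotMap_X]
  let e2 : (Pq ⧸ Ideal.span (MvPolynomial.X '' ({d} : Set {j : Fin n // j ≠ i}) : Set Pq)) ≃+*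
      (chartRing c i ⧸ KA) ⧸ (Ideal.span {chartGen c i d.1}).map (Ideal.Quotient.mk KA) :=
    Ideal.quotientEquiv _ _ (chartQuotEquiv c i hc) hIJ
  -- `Pq/(T_d) ≃ Tq`
  let e3 := (MvPolynomial.quotientSpanXEquiv (R := R ⧸ Ideal.span (Set.range c))
    ({d} : Set {j : Fin n // j ≠ i})).toRingEquiv
  refine ⟨e1.trans (e2.symm.trans e3), ?_⟩
  have h1 : e1 (Ideal.Quotient.mk _ v) = Ideal.Quotient.mk _ (Ideal.Quotient.mk KA v) :=
    DoubleQuot.quotQuotEquivQuotSup_symm_quotQuotMk KA _ v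
  have h2 : e2.symm (Ideal.Quotient.mk _ (Ideal.Quotient.mk KA v)) = Ideal.Quotient.mk _ F := by
    rw [← hv]
    change (Ideal.quotientEquiv _ _ (chartQuotEquiv c i hc) hIJ).symm _ = _
    rw [Ideal.quotientEquiv_symm_mk, RingEquiv.symm_apply_apply]
  rw [RingEquiv.trans_apply, RingEquiv.trans_apply, h1, h2, ← hG]
  rfl

/-- **`v` is regular modulo `(u, e_d)` when `G ≠ 0`** (`R/(c)` a domain: the target of
`exists_quotEquiv_killGen` is a polynomial ring over a domain). [folklore] -/
theorem forall_mem_of_mul_mem_of_ne_zero [IsDomain (R ⧸ Ideal.span (Set.range c))]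
    (hc : IsQuasiRegular c) (F : Pq) (v : chartRing c i)
    (hv : chartQuotEquiv c i hc F = Ideal.Quotient.mk KA v) (G : Tq)
    (hG : MvPolynomial.quotientSpanXEquiv ({d} : Set {j : Fin n // j ≠ i}) (Ideal.Quotient.mk _ F) = G)
    (hG0 : G ≠ 0) :
    ∀ g, v * g ∈ KA ⊔ Ideal.span {chartGen c i d.1} → g ∈ KA ⊔ Ideal.span {chartGen c i d.1} := by
  obtain ⟨θ, hθ⟩ := exists_quotEquiv_killGen c i d hc F v hv G hG
  intro g hg
  have h0 : θ (Ideal.Quotient.mk _ v) * θ (Ideal.Quotient.mk _ g) = 0 := by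
    rw [← map_mul, ← map_mul, Ideal.Quotient.eq_zero_iff_mem.mpr hg, map_zero]
  rw [hθ] at h0
  rcases mul_eq_zero.mp h0 with h | h
  · exact absurd h hG0
  · rw [← Ideal.Quotient.eq_zero_iff_mem]
    exact θ.injective (by rw [h, map_zero])

/-- **`(u, e_d, v)` is a weakly regular sequence on `B_i`** (`u` a non-zero-divisor, `e_d` a
variable modulo `u`, `v` regular modulo `(u, e_d)` by `forall_mem_of_mul_mem_of_ne_zero`).
[cite: StacksProject, Tag 0BIQ] [cite: Matsumura1987, Thm. 16.2 (i)] -/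
theorem isWeaklyRegular_u_gen_v [IsDomain (R ⧸ Ideal.span (Set.range c))]
    (hc : IsQuasiRegular c) (F : Pq) (v : chartRing c i)
    (hv : chartQuotEquiv c i hc F = Ideal.Quotient.mk KA v) (G : Tq)
    (hG : MvPolynomial.quotientSpanXEquiv ({d} : Set {j : Fin n // j ≠ i}) (Ideal.Quotient.mk _ F) = G)
    (hG0 : G ≠ 0) :
    RingTheory.Sequence.IsWeaklyRegular (chartRing c i)
      [chartBase c i (c i), chartGen c i d.1, v] := by
  have hu : chartBase c i (c i) ∈ (chartRing c i)⁰ :=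
    reesChartBase_mem_nonZeroDivisors (c i) (Ideal.mem_span_range_self (f := c) (x := i))
  refine isWeaklyRegular_three hu ?_ (forall_mem_of_mul_mem_of_ne_zero c i d hc F v hv G hG hG0)
  -- `e_d` is regular modulo `u`: the chart family `(u, e_d)`
  have h2 := CoreRungTower.isWeaklyRegular_chartFamily c i (fun _ : Fin 1 => d) hc
    (fun a b _ => Subsingleton.elim a b)
  have hl : List.ofFn (Fin.cons (chartBase c i (c i)) fun _ : Fin 1 => chartGen c i d.1) =
      [chartBase c i (c i)] ++ [chartGen c i d.1] := rfl
  rw [hl] at h2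
  have h3 := forall_mem_of_isWeaklyRegular_append_singleton h2
  rw [Ideal.ofList_singleton] at h3
  exact h3

/-- Hence `(u, e_d, v)` is quasi-regular. [cite: Matsumura1987, Thm. 16.2 (i)] -/
theorem isQuasiRegular_u_gen_v [IsDomain (R ⧸ Ideal.span (Set.range c))]
    (hc : IsQuasiRegular c) (F : Pq) (v : chartRing c i)
    (hv : chartQuotEquiv c i hc F = Ideal.Quotient.mk KA v) (G : Tq)
    (hG : MvPolynomial.quotientSpanXEquiv ({d} : Set {j : Fin n // j ≠ i}) (Ideal.Quotient.mk _ F) = G)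
    (hG0 : G ≠ 0) :
    IsQuasiRegular (![chartBase c i (c i), chartGen c i d.1, v] : Fin 3 → chartRing c i) :=
  isQuasiRegular_vec3 (isWeaklyRegular_u_gen_v c i d hc F v hv G hG hG0)

/-- **`B_i/(u, e_d, v)` is a regular ring under a Jacobian certificate for `G`**:
`B_i/(u, e_d, v) ≅ (R/(c))[T_j : j ≠ i, d]/(G)`, regular by the Jacobian criterion when at every
prime containing `G` some `∂G/∂T_j` is absent (`R/(c)` regular).
[cite: Matsumura1987, Thm. 14.2] [cite: StacksProject, Tag 0BIQ] -/
theorem isRegularRing_quot_u_gen_v [IsRegularRing (R ⧸ Ideal.span (Set.range c))]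
    (hc : IsQuasiRegular c) (F : Pq) (v : chartRing c i)
    (hv : chartQuotEquiv c i hc F = Ideal.Quotient.mk KA v) (G : Tq)
    (hG : MvPolynomial.quotientSpanXEquiv ({d} : Set {j : Fin n // j ≠ i}) (Ideal.Quotient.mk _ F) = G)
    (hJ : ∀ Q : Ideal Tq, Q.IsPrime → G ∈ Q → ∃ j, MvPolynomial.pderiv j G ∉ Q) :
    IsRegularRing (chartRing c i ⧸ (KA ⊔ Ideal.span {chartGen c i d.1} ⊔ Ideal.span {v})) := by
  obtain ⟨θ, hθ⟩ := exists_quotEquiv_killGen c i d hc F v hv G hG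
  haveI : IsRegularRing (Tq ⧸ Ideal.span {G}) := MvPolynomial.isRegularRing_quotient_span_of_pderiv hJ
  -- `B/(u, e_d, v) ≃ (B/(u, e_d))/(v̄) ≃ Tq/(G)`
  have e1 : (chartRing c i ⧸ (KA ⊔ Ideal.span {chartGen c i d.1} ⊔ Ideal.span {v})) ≃+*
      (chartRing c i ⧸ (KA ⊔ Ideal.span {chartGen c i d.1})) ⧸
        (Ideal.span {v}).map (Ideal.Quotient.mk (KA ⊔ Ideal.span {chartGen c i d.1})) :=
    (DoubleQuot.quotQuotEquivQuotSup _ _).symm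
  have hIJ : Ideal.span {G} = ((Ideal.span {v}).map
      (Ideal.Quotient.mk (KA ⊔ Ideal.span {chartGen c i d.1}))).map (θ : _ →+* Tq) := by
    rw [map_span_singleton, map_span_singleton, RingHom.coe_coe, hθ]
  have e2 := Ideal.quotientEquiv _ _ θ hIJ
  exact IsRegularRing.of_ringEquiv (R := Tq ⧸ Ideal.span {G}) (e1.trans e2).symm

end Transport

/-! ## The three Jacobian certificates -/

section Jacobian

variable {k : Type u} [CommRing k] {τ : Type} (a b : τ)

/-- `∂(T_a − T_b²)/∂T_a = 1`, so the Jacobian condition holds for `T_a − T_b²` (`a ≠ b`).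
[cite: Matsumura1987, Thm. 14.2] -/
theorem jacobian_X_sub_X_sq (hab : a ≠ b) :
    ∀ Q : Ideal (MvPolynomial τ k), Q.IsPrime →
      (MvPolynomial.X a - MvPolynomial.X b ^ 2 : MvPolynomial τ k) ∈ Q →
        ∃ j, MvPolynomial.pderiv j (MvPolynomial.X a - MvPolynomial.X b ^ 2 : MvPolynomial τ k) ∉ Q := by
  classical
  intro Q hQ _
  refine ⟨a, ?_⟩
  rw [map_sub, Derivation.leibniz_pow, MvPolynomial.pderiv_X_self,
    MvPolynomial.pderiv_X_of_ne hab.symm, smul_zero, smul_zero, sub_zero]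
  exact fun h => hQ.ne_top (Q.eq_top_of_isUnit_mem h isUnit_one)

/-- `T_a − T_b² ≠ 0` over a nontrivial ring (its `∂/∂T_a` is `1`). [folklore] -/
theorem X_sub_X_sq_ne_zero [Nontrivial k] (hab : a ≠ b) :
    (MvPolynomial.X a - MvPolynomial.X b ^ 2 : MvPolynomial τ k) ≠ 0 := by
  classical
  intro h
  have h1 := congrArg (MvPolynomial.pderiv a) h
  rw [map_sub, Derivation.leibniz_pow, MvPolynomial.pderiv_X_self,
    MvPolynomial.pderiv_X_of_ne hab.symm, smul_zero, smul_zero, sub_zero, map_zero] at h1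
  exact one_ne_zero h1

/-- `(T_a T_b − 1, ∂_b, ∂_a) = (T_a T_b − 1, T_a, T_b) = (1)`: the Jacobian condition holds for
`T_a T_b − 1` (`a ≠ b`). [cite: Matsumura1987, Thm. 14.2] -/
theorem jacobian_X_mul_X_sub_one (hab : a ≠ b) :
    ∀ Q : Ideal (MvPolynomial τ k), Q.IsPrime →
      (MvPolynomial.X a * MvPolynomial.X b - 1 : MvPolynomial τ k) ∈ Q →
        ∃ j, MvPolynomial.pderiv j (MvPolynomial.X a * MvPolynomial.X b - 1 : MvPolynomial τ k) ∉ Q := by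
  classical
  intro Q hQ hF
  by_contra h
  simp only [not_exists, not_not] at h
  have ha := h a
  have hb := h b
  rw [map_sub, Derivation.map_one_eq_zero, sub_zero, MvPolynomial.pderiv_mul,
    MvPolynomial.pderiv_X_self, MvPolynomial.pderiv_X_of_ne hab.symm, mul_zero, add_zero,
    one_mul] at ha
  rw [map_sub, Derivation.map_one_eq_zero, sub_zero, MvPolynomial.pderiv_mul,
    MvPolynomial.pderiv_X_of_ne hab, MvPolynomial.pderiv_X_self, zero_mul, zero_add,
    mul_one] at hb
  -- `T_b, T_a ∈ Q` and `T_a T_b − 1 ∈ Q` give `1 ∈ Q`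
  have h1 : (1 : MvPolynomial τ k) ∈ Q := by
    have h2 : MvPolynomial.X a * MvPolynomial.X b - (MvPolynomial.X a * MvPolynomial.X b - 1) ∈ Q :=
      Q.sub_mem (Q.mul_mem_right _ hb) hF
    rwa [sub_sub_cancel] at h2
  exact hQ.ne_top (Q.eq_top_of_isUnit_mem h1 isUnit_one)

/-- `T_a T_b − 1 ≠ 0` over a nontrivial ring (its constant coefficient is `−1`). [folklore] -/
theorem X_mul_X_sub_one_ne_zero [Nontrivial k] :
    (MvPolynomial.X a * MvPolynomial.X b - 1 : MvPolynomial τ k) ≠ 0 := by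
  classical
  intro h
  have h1 := congrArg (MvPolynomial.eval fun _ => (0 : k)) h
  rw [map_sub, map_mul, MvPolynomial.eval_X, MvPolynomial.eval_X, map_one, map_zero, zero_mul,
    zero_sub, neg_eq_zero] at h1
  exact one_ne_zero h1

end Jacobian

/-! ## The two centre shapes of the member on a Rees chart -/

section Shapes

variable {R : Type u} [CommRing R] {n : ℕ} (c : Fin n → R) (i : Fin n) (a b d : {j : Fin n // j ≠ i})

/-- **Charts of `x₀` and `x₁`** (`v = e_a − e_b²`): for `c` quasi-regular with `R/(c)` a regular
domain, `(u, e_d, e_a − e_b²)` is quasi-regular on `B_i` and `B_i/(u, e_d, e_a − e_b²)` is a regular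
ring (`G = T_a − T_b²`, `∂G/∂T_a = 1`). [cite: Matsumura1987, Thm. 14.2] [cite: StacksProject, Tag 0BIQ] -/
theorem hyps_gen_sub_gen_sq [IsDomain (R ⧸ Ideal.span (Set.range c))]
    [IsRegularRing (R ⧸ Ideal.span (Set.range c))] (hc : IsQuasiRegular c)
    (hab : a ≠ b) (had : a ≠ d) (hbd : b ≠ d) :
    IsQuasiRegular (![chartBase c i (c i), chartGen c i d.1,
      chartGen c i a.1 - chartGen c i b.1 ^ 2] : Fin 3 → chartRing c i) ∧
    IsRegularRing (chartRing c i ⧸ (Ideal.span {chartBase c i (c i)} ⊔ Ideal.span {chartGen c i d.1} ⊔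
      Ideal.span {chartGen c i a.1 - chartGen c i b.1 ^ 2})) := by
  classical
  have had' : a ∉ ({d} : Set {j : Fin n // j ≠ i}) := by rwa [Set.mem_singleton_iff]
  have hbd' : b ∉ ({d} : Set {j : Fin n // j ≠ i}) := by rwa [Set.mem_singleton_iff]
  have hab' : (⟨a, had'⟩ : {j : {j : Fin n // j ≠ i} // j ∉ ({d} : Set {j : Fin n // j ≠ i})}) ≠ ⟨b, hbd'⟩ :=
    fun h => hab (congrArg Subtype.val h)
  have hv : chartQuotEquiv c i hc (MvPolynomial.X a - MvPolynomial.X b ^ 2) =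
      Ideal.Quotient.mk (Ideal.span {chartBase c i (c i)}) (chartGen c i a.1 - chartGen c i b.1 ^ 2) := by
    rw [map_sub (Ideal.Quotient.mk _) (chartGen c i a.1) (chartGen c i b.1 ^ 2),
      map_pow (Ideal.Quotient.mk _) (chartGen c i b.1) 2, map_sub, map_pow, chartQuotEquiv_apply,
      chartQuotEquiv_apply, chartQuotMap_X, chartQuotMap_X]
  have hG : MvPolynomial.quotientSpanXEquiv ({d} : Set {j : Fin n // j ≠ i})
      (Ideal.Quotient.mk _ (MvPolynomial.X a - MvPolynomial.X b ^ 2 :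
        MvPolynomial {j : Fin n // j ≠ i} (R ⧸ Ideal.span (Set.range c)))) =
      MvPolynomial.X ⟨a, had'⟩ - MvPolynomial.X ⟨b, hbd'⟩ ^ 2 := by
    rw [map_sub, map_pow, map_sub, map_pow, MvPolynomial.quotientSpanXEquiv_mk_X,
      MvPolynomial.quotientSpanXEquiv_mk_X]
  exact ⟨isQuasiRegular_u_gen_v c i d hc _ _ hv _ hG (X_sub_X_sq_ne_zero _ _ hab'),
    isRegularRing_quot_u_gen_v c i d hc _ _ hv _ hG (jacobian_X_sub_X_sq _ _ hab')⟩

/-- **Chart of `x₂`** (`v = e_a e_b − 1`): for `c` quasi-regular with `R/(c)` a regular domain,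
`(u, e_d, e_a e_b − 1)` is quasi-regular on `B_i` and `B_i/(u, e_d, e_a e_b − 1)` is a regular ring
(`G = T_a T_b − 1`, `(G, T_a, T_b) = (1)`: the hyperbola chart of the conic).
[cite: Matsumura1987, Thm. 14.2] [cite: StacksProject, Tag 0BIQ] -/
theorem hyps_gen_mul_gen_sub_one [IsDomain (R ⧸ Ideal.span (Set.range c))]
    [IsRegularRing (R ⧸ Ideal.span (Set.range c))] (hc : IsQuasiRegular c)
    (hab : a ≠ b) (had : a ≠ d) (hbd : b ≠ d) :
    IsQuasiRegular (![chartBase c i (c i), chartGen c i d.1,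
      chartGen c i a.1 * chartGen c i b.1 - 1] : Fin 3 → chartRing c i) ∧
    IsRegularRing (chartRing c i ⧸ (Ideal.span {chartBase c i (c i)} ⊔ Ideal.span {chartGen c i d.1} ⊔
      Ideal.span {chartGen c i a.1 * chartGen c i b.1 - 1})) := by
  classical
  have had' : a ∉ ({d} : Set {j : Fin n // j ≠ i}) := by rwa [Set.mem_singleton_iff]
  have hbd' : b ∉ ({d} : Set {j : Fin n // j ≠ i}) := by rwa [Set.mem_singleton_iff]
  have hab' : (⟨a, had'⟩ : {j : {j : Fin n // j ≠ i} // j ∉ ({d} : Set {j : Fin n // j ≠ i})}) ≠ ⟨b, hbd'⟩ :=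
    fun h => hab (congrArg Subtype.val h)
  have hv : chartQuotEquiv c i hc (MvPolynomial.X a * MvPolynomial.X b - 1) =
      Ideal.Quotient.mk (Ideal.span {chartBase c i (c i)}) (chartGen c i a.1 * chartGen c i b.1 - 1) := by
    rw [map_sub (Ideal.Quotient.mk _) (chartGen c i a.1 * chartGen c i b.1) 1,
      map_mul (Ideal.Quotient.mk _) (chartGen c i a.1) (chartGen c i b.1),
      map_one (Ideal.Quotient.mk (Ideal.span {chartBase c i (c i)})), map_sub, map_mul, map_one,
      chartQuotEquiv_apply, chartQuotEquiv_apply, chartQuotMap_X, chartQuotMap_X]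
  have hG : MvPolynomial.quotientSpanXEquiv ({d} : Set {j : Fin n // j ≠ i})
      (Ideal.Quotient.mk _ (MvPolynomial.X a * MvPolynomial.X b - 1 :
        MvPolynomial {j : Fin n // j ≠ i} (R ⧸ Ideal.span (Set.range c)))) =
      MvPolynomial.X ⟨a, had'⟩ * MvPolynomial.X ⟨b, hbd'⟩ - 1 := by
    rw [map_sub, map_mul, map_one, map_sub, map_mul, map_one, MvPolynomial.quotientSpanXEquiv_mk_X,
      MvPolynomial.quotientSpanXEquiv_mk_X]
  exact ⟨isQuasiRegular_u_gen_v c i d hc _ _ hv _ hG (X_mul_X_sub_one_ne_zero _ _),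
    isRegularRing_quot_u_gen_v c i d hc _ _ hv _ hG (jacobian_X_mul_X_sub_one _ _ hab')⟩

end Shapes

end TwoQuadric

end Summit.ResolutionOfSingularities.ResolutionOfSingularities.Theorems

end
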